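import Mathlib
import HarnessLib
import Summits.HubbardSuperconductivity.HubbardSuperconductivity.Theses.ChiralWindow
import Literature.MathematicalPhysics.QuantumLattice.DWaveOrderParameterProofs
import Literature.MathematicalPhysics.QuantumLattice.GroundStateSourceBounds
import Summits.HubbardSuperconductivity.HubbardSuperconductivity.Theorems.ChiralWindowCwChiralConstructionSecondOrderEnergyBounds
import Summits.HubbardSuperconductivity.HubbardSuperconductivity.Theorems.ChiralWindowCwChiralConstructionSlopeOfEnergyBounds
import Summits.HubbardSuperconductivity.HubbardSuperconductivity.Theorems.ChiralWindowCwChiralConstructionBudgetOfSlope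
import Summits.HubbardSuperconductivity.HubbardSuperconductivity.Theorems.ChiralWindowCwChiralConstructionDensityOfLimits
import Summits.HubbardSuperconductivity.HubbardSuperconductivity.Theorems.ChiralWindowCwChiralConstructionFreeBandLimit
import Summits.HubbardSuperconductivity.HubbardSuperconductivity.Theorems.WeakCouplingBCSWcbcsBcsConstructionEnergyDensityLimit

/-!
# Crux `CwChiralConstruction` (stmt-HubbardSuperconductivity-1740), line `susceptibility-rise-budget`:
# the lead's skeleton

Route `HubbardSuperconductivity/ChiralWindow`, rank-2 crux (the programme). LINE (idea card
`Cruxes/CwChiralConstruction/Ideas/susceptibility-rise-budget.md`): the Koma–Tasaki floor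
`exp(-C/U²) ≤ dWaveOrderParameter U μ` is obtained from ONE-POINT ORDER at a single doubly-sourced
corner `P* = (s₀, s₀)` (B₁g source `-s(Δ_d + Δ_d†)` and a partner co-source `-t·Y_L`) plus two
gap×variance TRANSPORT legs (`(s, s₀)`, `s ↓ h'`, then `(h', t)`, `t ↓ h'`) landing on the diagonal
`(h', h')`, and a DIAGONAL TRANSFER `(h', h') → dWaveOrderParameter` (trial-state domination, the
co-source costing `h'‖Y‖ = o(h)` against the stair `h`).

Registered stubs (lead's reshaped skeleton, 7 = stubs_max; the crux-plan's three stubs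
`stub_susceptibilityBudget` / `stub_genericDensity` / `stub_chiralCornerWindow` are kept — the first two
now DERIVED (`cw_susceptibilityBudget`, `cw_genericDensity`) from smaller registered pieces):
* `stub_secondOrderEnergyBounds` — two-sided second-order perturbation bounds for the ground energy of a
  Hermitian matrix with a unique gapped ground state (reduced resolvent `R`, state-level clauses);
* `stub_slopeOfEnergyBounds` — from those bounds, the local slope (Dini) estimate
  `|Re ω_{K-τY}(O) - Re ω_K(O)| ≤ (2√(Var O · Var Y)/γ + ε)|τ|` (Hellmann–Feynman without analytic
  perturbation theory: supergradient sandwich at the perturbed point, `λ = τ^{3/2}`);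
* `stub_budgetOfSlope` — integration of the slope estimate along `[t₁, t₂]` (gap `c t^a`, variances
  `V t^{-b}`, `a + b < 1`) to the registered budget `stub_susceptibilityBudget`;
* `stub_gcEnergyTL` — thermodynamic limit of the grand-canonical ground-energy density on the tori
  (assembly of the sibling crux's landed box/tiling/comparison stubs);
* `stub_freeBandLimit` — the free band: limit density `e₀`, `e₀' = -filling`, continuity and the two
  saturation values of `KohnLuttinger.filling (squareDispersion 1 0)`;
* `stub_densityOfLimits` — Griffiths + concavity + slope stability: the two limits above give the
  registered density clause `stub_genericDensity`;
* `stub_chiralCornerWindow` — THE CORE (verbatim): filling window, co-source family, corner value `A` and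
  the gap/variance families along the two legs, with `exp(-C/U²) ≤ A - (leg budgets)`.
Frame (proved here): `cw_susceptibilityBudget`, `cw_genericDensity`, `cw_diagonal_fin`,
`cw_diagonalTransfer`, `CwChiralConstruction_of`.
-/

set_option linter.dupNamespace false

namespace Summit.HubbardSuperconductivity.HubbardSuperconductivity.Theorems

open Literature.MathematicalPhysics.QuantumLattice Literature.Probability.LatticeModels Matrix Filter
open Summit.HubbardSuperconductivity.HubbardSuperconductivity.Theses.ChiralWindow
open scoped Matrix.Norms.L2Operator ComplexOrder Topology

/-! ### Registered stubs -/

-- LANDED and imported (used by name below):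
--   `stub_secondOrderEnergyBounds` — p81552 (…SecondOrderEnergyBounds.lean; lemmas p79041 …SecondOrderEnergyBoundsLemmas.lean)
--   `stub_slopeOfEnergyBounds`     — p84428 (…SlopeOfEnergyBounds.lean)
--   `stub_budgetOfSlope`           — p85426 (…BudgetOfSlope.lean)
--   `stub_gcEnergyTL`              — verbatim the sibling crux's accepted `stub_torusGcEnergyDensityLimit`
--                                    (p76736, WeakCouplingBCSWcbcsBcsConstructionEnergyDensityLimit.lean); used under that name
--   `stub_densityOfLimits`         — p85392 (…DensityOfLimits.lean)

/-- **The gap×variance transport budget** (the crux-plan's registered `stub_susceptibilityBudget`,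
now derived): along `K - tY`, `t ∈ [t₁, t₂]`, unique ground state of gap `≥ c t^a`, connected
fluctuations of `O` and `Y` `≤ V t^{-b}`, `a + b < 1` ⟹ the sourced one-point function of `O` moves by at
most `2V/(c(1-(a+b))) · (t₂^{1-(a+b)} - t₁^{1-(a+b)})`. [folklore: Kato, Hellmann–Feynman] -/
theorem cw_susceptibilityBudget :
    ∀ {n : Type} [Fintype n] [DecidableEq n] [Nonempty n] (K O Y : Matrix n n ℂ), K.IsHermitian → O.IsHermitian → Y.IsHermitian → ∀ (c V a b t₁ t₂ : ℝ), 0 < c → 0 ≤ V → a + b < 1 → 0 < t₁ → t₁ ≤ t₂ → (∀ t ∈ Set.Icc t₁ t₂, (K - (t : ℂ) • Y).HasSpectralGap (c * t ^ a)) → (∀ t ∈ Set.Icc t₁ t₂, ((K - (t : ℂ) • Y).groundStateFunctional (O * O)).re - ((K - (t : ℂ) • Y).groundStateFunctional O).re ^ 2 ≤ V * t ^ (-b)) → (∀ t ∈ Set.Icc t₁ t₂, ((K - (t : ℂ) • Y).groundStateFunctional (Y * Y)).re - ((K - (t : ℂ) • Y).groundStateFunctional Y).re ^ 2 ≤ V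 * t ^ (-b)) → |((K - (t₂ : ℂ) • Y).groundStateFunctional O).re - ((K - (t₁ : ℂ) • Y).groundStateFunctional O).re| ≤ 2 * V / (c * (1 - (a + b))) * (t₂ ^ (1 - (a + b)) - t₁ ^ (1 - (a + b))) :=
  stub_budgetOfSlope (stub_slopeOfEnergyBounds stub_secondOrderEnergyBounds)

-- `stub_freeBandLimit` LANDED — p86909 (ChiralWindowCwChiralConstructionFreeBandLimit.lean), imported above.
-- The frame below (`cw_diagonal_fin`, `cw_diagonalTransfer`, and the composition packaged as the reduction
-- `stub_cruxOfCorner : core → crux`) is LANDED too: p89015 …DiagonalTransfer.lean, p90642 …CornerReduction.lean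
-- (kept inline here so that the skeleton's composition stays a closed term over the ONE open stub).

/-- **The density clause at a generic chemical potential** (the crux-plan's registered
`stub_genericDensity`, now derived from the landed `stub_torusGcEnergyDensityLimit` (sibling crux), `stub_freeBandLimit`, `stub_densityOfLimits`).
[folklore: Griffiths 1964; Ruelle 1969] -/
theorem cw_genericDensity :
    ∀ η : ℝ, 0 < η → ∃ U₁ : ℝ, 0 < U₁ ∧ ∀ U ∈ Set.Ioo (0 : ℝ) U₁, ∀ μ₁ μ₂ : ℝ, μ₁ < μ₂ → (∀ μ ∈ Set.Icc μ₁ μ₂, KohnLuttinger.filling (squareDispersion 1 0) μ ∈ Set.Icc (13 / 25 + η) (7 / 10 - η)) → ∃ μ ∈ Set.Ioo μ₁ μ₂, ∃ δ ∈ Set.Icc (3 / 10 : ℝ) (12 / 25), Tendsto (fun L : ℕ => ((hubbardTorusWith 2 (L + 1) 1 U μ).groundStateFunctional totalNumber).re / ((L + 1 : ℕ) : ℝ) ^ 2) atTop (𝓝 (1 - δ)) :=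
  stub_densityOfLimits stub_torusGcEnergyDensityLimit stub_freeBandLimit

/-- **Stub `stub_chiralCornerWindow`** (THE CORE — the chiral-window construction at the comfortable
corner). For all weak repulsive `U` there are a filling window, a Hermitian co-source family `Y_L`
(`‖Y_L‖ ≤ b_Y (L+1)²`), a corner `s₀`, a corner value `A` and gap/variance data along the two legs
`{(s, s₀)}_{s ∈ [h', s₀]}` and `{(h', t)}_{t ∈ [h', s₀]}` (per compact, `L₀ = L₀(h')`) with
`exp(-C/U²) ≤ A - (leg budgets)`. This is the constructive programme itself (weak-coupling BCS /
Kohn–Luttinger regime below the gap scale); no known rigorous method reaches it. [conjectural step] -/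
theorem stub_chiralCornerWindow :
    ∃ η U₀ C : ℝ, 0 < η ∧ 0 < U₀ ∧ 0 < C ∧ ∀ U ∈ Set.Ioo (0 : ℝ) U₀, ∃ μ₁ μ₂ : ℝ, μ₁ < μ₂ ∧ (∀ μ ∈ Set.Icc μ₁ μ₂, KohnLuttinger.filling (squareDispersion 1 0) μ ∈ Set.Icc (13 / 25 + η) (7 / 10 - η)) ∧ ∀ μ ∈ Set.Ioo μ₁ μ₂, ∃ (Y : ∀ L : ℕ, Matrix (Finset (Orb (FermionTorus 2 (L + 1)))) (Finset (Orb (FermionTorus 2 (L + 1)))) ℂ) (bY s₀ A c V a b c₁ V₁ a₁ b₁ : ℝ), (∀ L, (Y L).IsHermitian) ∧ (∀ L, ‖Y L‖ ≤ bY * ((L + 1 : ℕ) : ℝ) ^ 2) ∧ 0 < s₀ ∧ 0 < c ∧ 0 ≤ V ∧ a + b < 1 ∧ 0 < c₁ ∧ 0 ≤ V₁ ∧ a₁ + b₁ < 1 ∧ Real.exp (-C / U ^ 2) ≤ A - V / (c * (1 - (a + b))) * s₀ ^ (1 - (a + b)) - V₁ / (c₁ * (1 - (a₁ + b₁))) *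 s₀ ^ (1 - (a₁ + b₁)) ∧ (∀ᶠ L : ℕ in atTop, A ≤ ((hubbardTorusWith 2 (L + 1) 1 U μ - (s₀ : ℂ) • Y L - (s₀ : ℂ) • (pairField dWaveFormFactor (L + 1) + (pairField dWaveFormFactor (L + 1))ᴴ) ).groundStateFunctional (pairField dWaveFormFactor (L + 1))).re / ((L + 1 : ℕ) : ℝ) ^ 2) ∧ ∀ h' ∈ Set.Ioo (0 : ℝ) s₀, ∀ᶠ L : ℕ in atTop, (∀ s ∈ Set.Icc h' s₀, (hubbardTorusWith 2 (L + 1) 1 U μ - (s₀ : ℂ) • Y L - (s : ℂ) • (pairField dWaveFormFactor (L + 1) + (pairField dWaveFormFactor (L + 1))ᴴ) ).HasSpectralGap (c * s ^ a) ∧ ((hubbardTorusWith 2 (L + 1) 1 U μ - (s₀ : ℂ) • Y L - (s : ℂ) • (pairField dWaveFormFactor (L + 1) + (pairField dWaveFormFactor (L + 1))ᴴ) ).groundStateFunctional ((pairField dWaveFormFactor (L + 1) + (pairField dWaveFormFactor (L + 1))ᴴ) * (pairField dWaveFormFactor (L + 1) + (pairField dWaveFormFactor (L + 1))ᴴ))).re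 - ((hubbardTorusWith 2 (L + 1) 1 U μ - (s₀ : ℂ) • Y L - (s : ℂ) • (pairField dWaveFormFactor (L + 1) + (pairField dWaveFormFactor (L + 1))ᴴ) ).groundStateFunctional (pairField dWaveFormFactor (L + 1) + (pairField dWaveFormFactor (L + 1))ᴴ)).re ^ 2 ≤ V * ((L + 1 : ℕ) : ℝ) ^ 2 * s ^ (-b)) ∧ (∀ t ∈ Set.Icc h' s₀, (dWaveSourceTorus (L + 1) U μ h' - (t : ℂ) • Y L).HasSpectralGap (c₁ * t ^ a₁) ∧ ((dWaveSourceTorus (L + 1) U μ h' - (t : ℂ) • Y L).groundStateFunctional ((pairField dWaveFormFactor (L + 1) + (pairField dWaveFormFactor (L + 1))ᴴ) * (pairField dWaveFormFactor (L + 1) + (pairField dWaveFormFactor (L + 1))ᴴ))).re - ((dWaveSourceTorus (L + 1) U μ h' - (t : ℂ) • Y L).groundStateFunctional (pairField dWaveFormFactor (L + 1) + (pairField dWaveFormFactor (L + 1))ᴴ)).re ^ 2 ≤ V₁ * ((L + 1 : ℕ) : ℝ) ^ 2 * t ^ (-b₁) ∧ ((dWaveSourceTorus (L + 1) U μ h'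 - (t : ℂ) • Y L).groundStateFunctional (Y L * Y L)).re - ((dWaveSourceTorus (L + 1) U μ h' - (t : ℂ) • Y L).groundStateFunctional (Y L)).re ^ 2 ≤ V₁ * ((L + 1 : ℕ) : ℝ) ^ 2 * t ^ (-b₁)) := by
  sorry

/-! ### Frame, part 1: the diagonal transfer `(h', h') ⟶ dWaveOrderParameter` -/

/-- **Diagonal domination, finite volume.** For the grand-canonical torus `K = hubbardTorusWith 2 L 1 U μ`,
the pair operator `O = Δ_d + Δ_d†`, ANY Hermitian co-source `Yv`, `h' ≥ 0` and real `h`: the ground state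
of the doubly-sourced `K - h'O - h'Yv` is a trial state for the stair Hamiltonian `K - hO`, and the
co-source never lowers `E₀(K)` by more than `h'‖Yv‖` beyond what `O` does (`Re ω_K(O) = 0` by `U(1)`), so
`2h · Re ω_{K-h'O-h'Yv}(Δ_d) - 2h'(B_d L² + ‖Yv‖) ≤ E₀(K) - E₀(K - hO)`. [folklore convexity] -/
theorem cw_diagonal_fin (L : ℕ) [NeZero L] (U μ h : ℝ) {h' : ℝ} (hh' : 0 ≤ h')
    (Yv : Matrix (Finset (Orb (FermionTorus 2 L))) (Finset (Orb (FermionTorus 2 L))) ℂ)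
    (hYv : Yv.IsHermitian) :
    2 * h * ((dWaveSourceTorus L U μ h' - (h' : ℂ) • Yv).groundStateFunctional
        (pairField dWaveFormFactor L)).re -
      2 * h' * ((2 * ∑ e ∈ insert (0 : Site 2) unitSteps, |dWaveFormFactor e / Real.sqrt 2|) * (L : ℝ) ^ 2
        + ‖Yv‖) ≤
      (dWaveSourceTorus L U μ 0).groundEnergy - (dWaveSourceTorus L U μ h).groundEnergy := by
  set Bd : ℝ := 2 * ∑ e ∈ insert (0 : Site 2) unitSteps, |dWaveFormFactor e / Real.sqrt 2| with hBd
  set K := hubbardTorusWith 2 L 1 U μ with hKdef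
  set P := pairField dWaveFormFactor L with hPdef
  set O := P + Pᴴ with hOdef
  have hK : K.IsHermitian := isHermitian_hubbardTorusWith L 1 U μ
  have hO : O.IsHermitian := isHermitian_pairField_add_conjTranspose L
  have hsa : ∀ r : ℝ, IsSelfAdjoint (r : ℂ) := fun r => by
    rw [isSelfAdjoint_iff, Complex.star_def, Complex.conj_ofReal]
  have hOY : (O + Yv).IsHermitian := hO.add hYv
  -- the doubly-sourced Hamiltonian `A = K - h'(O + Yv)`
  set A := K - (h' : ℂ) • (O + Yv) with hAdef
  have hA : A.IsHermitian := isHermitian_sub_real_smul hK hOY h'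
  have hAeq : dWaveSourceTorus L U μ h' - (h' : ℂ) • Yv = A := by
    rw [hAdef, hOdef, hPdef, hKdef, dWaveSourceTorus_eq]
    simp only [smul_add]
    abel
  have hsrc0 : dWaveSourceTorus L U μ 0 = K := dWaveSourceTorus_zero L U μ
  have hsrch : dWaveSourceTorus L U μ h = K - (h : ℂ) • O := dWaveSourceTorus_eq L U μ h
  -- (1) trial state: `E₀(K - hO) ≤ E₀(A) + h' Re ω_A(O + Yv) - h Re ω_A(O)`
  have hB : (K - (h : ℂ) • O).IsHermitian := isHermitian_sub_real_smul hK hO h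
  have h1 := Matrix.groundEnergy_le_groundStateFunctional_re hA hB
  have hdec : K - (h : ℂ) • O = A + (h' : ℂ) • (O + Yv) - (h : ℂ) • O := by
    rw [hAdef]; abel
  rw [hdec, map_sub, map_add, map_smul, map_smul, Matrix.groundStateFunctional_hamiltonian hA] at h1
  simp only [Complex.sub_re, Complex.add_re, Complex.ofReal_re, smul_eq_mul,
    Complex.re_ofReal_mul] at h1
  -- (2) the co-source lowers `E₀(K)` by at most `h'‖Yv‖` beyond `O`: `E₀(A) ≤ E₀(K) + h'‖Yv‖`
  have h2 : A.groundEnergy ≤ K.groundEnergy + h' * ‖Yv‖ := by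
    have key := sub_mul_re_groundStateFunctional_le hK hOY 0 h'
    simp only [Complex.ofReal_zero, zero_smul, sub_zero] at key
    have hP0 : K.groundStateFunctional P = 0 :=
      groundStateFunctional_hubbardTorusWith_pairField (g := dWaveFormFactor) (L := L) 1 U μ
    have hO0 : (K.groundStateFunctional O).re = 0 := by
      rw [hOdef, map_add, Complex.add_re, groundStateFunctional_conjTranspose_re, hP0]
      simp
    have hY0 : -‖Yv‖ ≤ (K.groundStateFunctional Yv).re :=
      (abs_le.1 (abs_re_groundStateFunctional_le_norm hK Yv)).1
    have hsum : (K.groundStateFunctional (O + Yv)).re = (K.groundStateFunctional Yv).re := by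
      rw [map_add, Complex.add_re, hO0, zero_add]
    rw [hsum] at key
    rw [← hAdef] at key
    nlinarith [key, hY0, hh']
  -- (3) a priori bounds on the one-point functions in the state `ω_A`
  have hL := cast_sq_pos_of_neZero L
  have hPbd : |(A.groundStateFunctional P).re| ≤ Bd * (L : ℝ) ^ 2 :=
    (abs_re_groundStateFunctional_le_norm hA P).trans (norm_pairField_le dWaveFormFactor L)
  have hObd : (A.groundStateFunctional O).re ≤ 2 * (Bd * (L : ℝ) ^ 2) := by
    rw [hOdef, map_add, Complex.add_re, groundStateFunctional_conjTranspose_re]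
    have := (abs_le.1 hPbd).2
    linarith
  have hYbd : (A.groundStateFunctional Yv).re ≤ ‖Yv‖ :=
    (le_abs_self _).trans (abs_re_groundStateFunctional_le_norm hA Yv)
  have hOYre : (A.groundStateFunctional (O + Yv)).re =
      (A.groundStateFunctional O).re + (A.groundStateFunctional Yv).re := by
    rw [map_add, Complex.add_re]
  have hOre : (A.groundStateFunctional O).re = 2 * (A.groundStateFunctional P).re := by
    rw [hOdef, map_add, Complex.add_re, groundStateFunctional_conjTranspose_re]; ring
  rw [hAeq, hsrc0, hsrch, hdec]
  rw [hOYre, hOre] at h1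
  have h3 : h' * (2 * (A.groundStateFunctional P).re + (A.groundStateFunctional Yv).re) ≤
      h' * (2 * (Bd * (L : ℝ) ^ 2) + ‖Yv‖) := by
    refine mul_le_mul_of_nonneg_left ?_ hh'
    rw [← hOre]
    linarith
  nlinarith [h1, h2, h3]

/-- **Diagonal transfer.** If for all small `h > 0` the `d`-wave pair density of the tracial ground
state of the doubly-sourced torus `dWaveSourceTorus (L+1) U μ h - h·Y_L` (equal strengths: the
DIAGONAL of the two-source corner) is eventually-in-`L` at least `ε`, for a Hermitian co-source family
with `‖Y_L‖ ≤ b_Y (L+1)²`, then `ε ≤ dWaveOrderParameter U μ`: against the stair `h` use the diagonal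
point `(h', h')` with `h' = o(h)` (`cw_diagonal_fin`, then `le_dWaveOrderParameter_of_le_liminf_energyGain`).
This is the registered frame lemma `stub_diagonalTransfer` of the crux-plan (proved). [folklore] -/
theorem cw_diagonalTransfer (U μ ε bY : ℝ)
    (Y : ∀ L : ℕ, Matrix (Finset (Orb (FermionTorus 2 (L + 1)))) (Finset (Orb (FermionTorus 2 (L + 1)))) ℂ)
    (hY : ∀ L, (Y L).IsHermitian) (hYn : ∀ L, ‖Y L‖ ≤ bY * ((L + 1 : ℕ) : ℝ) ^ 2)
    (hfloor : ∃ s₁ : ℝ, 0 < s₁ ∧ ∀ h ∈ Set.Ioo (0 : ℝ) s₁, ∀ᶠ L : ℕ in atTop,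
      ε ≤ ((dWaveSourceTorus (L + 1) U μ h - (h : ℂ) • Y L).groundStateFunctional
        (pairField dWaveFormFactor (L + 1))).re / ((L + 1 : ℕ) : ℝ) ^ 2) :
    ε ≤ dWaveOrderParameter U μ := by
  obtain ⟨s₁, hs₁, hfloor⟩ := hfloor
  set Bd : ℝ := 2 * ∑ e ∈ insert (0 : Site 2) unitSteps, |dWaveFormFactor e / Real.sqrt 2| with hBd
  have hBd0 : 0 ≤ Bd := by positivity
  have hb : 0 ≤ bY := by
    have h1 := hYn 0
    have h2 : (0 : ℝ) ≤ ‖Y 0‖ := norm_nonneg _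
    have h3 : ((0 + 1 : ℕ) : ℝ) ^ 2 = 1 := by norm_num
    rw [h3, mul_one] at h1
    linarith
  refine le_dWaveOrderParameter_of_le_liminf_energyGain U μ one_pos fun h hh => ?_
  have hhpos : 0 < h := hh.1
  apply le_of_forall_pos_le_add
  intro η hη
  -- the diagonal source strength `h' = o(h)`
  set h' : ℝ := min (s₁ / 2) (h * η / (Bd + bY + 1)) with hh'def
  have hden : 0 < Bd + bY + 1 := by linarith
  have hh'pos : 0 < h' := lt_min (by linarith) (by positivity)
  have hh'lt : h' < s₁ := (min_le_left _ _).trans_lt (by linarith)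
  have hh'le : h' ≤ h * η / (Bd + bY + 1) := min_le_right _ _
  have hcorr : h' * (Bd + bY) ≤ h * η := by
    have : h' * (Bd + bY + 1) ≤ h * η := by rwa [le_div_iff₀ hden] at hh'le
    nlinarith [hh'pos.le]
  have hF := hfloor h' ⟨hh'pos, hh'lt⟩
  -- pointwise comparison for every `L`
  have hpt : ∀ L : ℕ,
      ((dWaveSourceTorus (L + 1) U μ h' - (h' : ℂ) • Y L).groundStateFunctional
            (pairField dWaveFormFactor (L + 1))).re / ((L + 1 : ℕ) : ℝ) ^ 2 - η ≤
        ((dWaveSourceTorus (L + 1) U μ 0).groundEnergy - (dWaveSourceTorus (L + 1) U μ h).groundEnergy) /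
          (2 * h * (((L + 1 : ℕ) : ℝ)) ^ 2) := by
    intro L
    have hL : (0 : ℝ) < ((L + 1 : ℕ) : ℝ) ^ 2 := cast_sq_pos_of_neZero (L + 1)
    have key := cw_diagonal_fin (L + 1) U μ h hh'pos.le (Y L) (hY L)
    have hn := hYn L
    rw [div_sub' (hc := hL.ne'), div_le_div_iff₀ hL (by positivity)]
    set X := ((dWaveSourceTorus (L + 1) U μ h' - (h' : ℂ) • Y L).groundStateFunctional
            (pairField dWaveFormFactor (L + 1))).re with hX
    set n2 := ((L + 1 : ℕ) : ℝ) ^ 2 with hn2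
    have key' : 2 * h * X - 2 * h' * (Bd * n2 + ‖Y L‖) ≤
        (dWaveSourceTorus (L + 1) U μ 0).groundEnergy - (dWaveSourceTorus (L + 1) U μ h).groundEnergy := by
      rw [← hBd] at key
      exact key
    have hc2 : 2 * h' * (Bd * n2 + ‖Y L‖) ≤ 2 * h * η * n2 := by
      have h1 : Bd * n2 + ‖Y L‖ ≤ (Bd + bY) * n2 := by nlinarith [hn]
      have h2 : 2 * h' * (Bd * n2 + ‖Y L‖) ≤ 2 * h' * ((Bd + bY) * n2) :=
        mul_le_mul_of_nonneg_left h1 (by positivity)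
      have h3 : 2 * h' * ((Bd + bY) * n2) = 2 * (h' * (Bd + bY)) * n2 := by ring
      have h4 : 2 * (h' * (Bd + bY)) * n2 ≤ 2 * (h * η) * n2 :=
        mul_le_mul_of_nonneg_right (by linarith) hL.le
      linarith
    nlinarith [key', hc2, hL]
  -- a priori bounds for the liminf comparison
  have hup : ∀ L : ℕ,
      ((dWaveSourceTorus (L + 1) U μ 0).groundEnergy - (dWaveSourceTorus (L + 1) U μ h).groundEnergy) /
          (2 * h * (((L + 1 : ℕ) : ℝ)) ^ 2) ≤ Bd := fun L =>
    (energyGain_div_le_dWaveSourceDensity (L := L + 1) U μ hhpos).trans (dWaveSourceDensity_le_const (L + 1) U μ h)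
  have hmain : ε - η ≤ liminf (fun L : ℕ =>
      ((dWaveSourceTorus (L + 1) U μ 0).groundEnergy - (dWaveSourceTorus (L + 1) U μ h).groundEnergy) /
        (2 * h * (((L + 1 : ℕ) : ℝ)) ^ 2)) atTop := by
    refine le_liminf_of_le (isCoboundedUnder_ge_of_eventually_le atTop (Eventually.of_forall hup)) ?_
    filter_upwards [hF] with L hL
    have := hpt L
    linarith
  linarith

/-! ### Frame, part 2: corner value + two transport legs ⟹ diagonal floor ⟹ the crux -/

/-- **Composition.** The registered stubs imply the crux `CwChiralConstruction` BY NAME: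
the core gives (per `U`) the filling window and (per `μ`) the corner data; `cw_genericDensity` picks a
`μ` in the window with a convergent density `1 - δ`, `δ ∈ [3/10, 12/25]`; two applications of
`cw_susceptibilityBudget` (leg `(s, s₀)`, direction `O`; leg `(h', t)`, direction `Y_L`) carry the
corner value `2A(L+1)² ≤ Re ω(O)` to the diagonal `(h', h')` up to the two budgets; `Re ω(Δ_d) = ½ Re ω(O)`
and the core inequality give the floor `exp(-C/U²)` there, eventually in `L`, for every `h' ∈ (0, s₀)`;
`cw_diagonalTransfer` concludes. -/
theorem CwChiralConstruction_of : CwChiralConstruction := by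
  obtain ⟨η, U₀, C, hη, hU₀, hC, core⟩ := stub_chiralCornerWindow
  obtain ⟨U₁, hU₁, dens⟩ := cw_genericDensity η hη
  refine ⟨min U₀ U₁, lt_min hU₀ hU₁, C, hC, fun U hU => ?_⟩
  have hUU₀ : U ∈ Set.Ioo (0 : ℝ) U₀ := ⟨hU.1, hU.2.trans_le (min_le_left _ _)⟩
  have hUU₁ : U ∈ Set.Ioo (0 : ℝ) U₁ := ⟨hU.1, hU.2.trans_le (min_le_right _ _)⟩
  obtain ⟨μ₁, μ₂, h12, hfill, hcorner⟩ := core U hUU₀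
  obtain ⟨μ, hμ, δ, hδ, hdens⟩ := dens U hUU₁ μ₁ μ₂ h12 hfill
  refine ⟨δ, hδ, μ, hdens, ?_⟩
  obtain ⟨Y, bY, s₀, A, c, V, a, b, c₁, V₁, a₁, b₁, hY, hYn, hs₀, hc, hV, hab, hc₁, hV₁, hab₁, hineq,
    hcornerval, hlegs⟩ := hcorner μ hμ
  refine cw_diagonalTransfer U μ _ bY Y hY hYn ⟨s₀, hs₀, fun h' hh' => ?_⟩
  have hh'pos : 0 < h' := hh'.1
  have hh'le : h' ≤ s₀ := hh'.2.le
  set e₁ : ℝ := 1 - (a + b) with he₁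
  set e₂ : ℝ := 1 - (a₁ + b₁) with he₂
  have he₁pos : 0 < e₁ := by rw [he₁]; linarith
  have he₂pos : 0 < e₂ := by rw [he₂]; linarith
  filter_upwards [hcornerval, hlegs h' hh'] with L hAL hlegL
  obtain ⟨hleg1, hleg2⟩ := hlegL
  -- notation
  set n2 : ℝ := ((L + 1 : ℕ) : ℝ) ^ 2 with hn2
  have hn2pos : 0 < n2 := cast_sq_pos_of_neZero (L + 1)
  set K := hubbardTorusWith 2 (L + 1) 1 U μ with hKdef
  set P := pairField dWaveFormFactor (L + 1) with hPdef
  set O := P + Pᴴ with hOdef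
  have hK : K.IsHermitian := isHermitian_hubbardTorusWith (L + 1) 1 U μ
  have hO : O.IsHermitian := isHermitian_pairField_add_conjTranspose (L + 1)
  have hsa : ∀ r : ℝ, IsSelfAdjoint (r : ℂ) := fun r => by
    rw [isSelfAdjoint_iff, Complex.star_def, Complex.conj_ofReal]
  -- leg 1: base `K₁ = K - s₀ Y_L`, direction `O`, observable `O`, `s ∈ [h', s₀]`
  set K₁ := K - (s₀ : ℂ) • Y L with hK₁def
  have hK₁ : K₁.IsHermitian := isHermitian_sub_real_smul hK (hY L) s₀
  have budget1 := cw_susceptibilityBudget K₁ O O hK₁ hO hO c (V * n2) a b h' s₀ hc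
    (mul_nonneg hV hn2pos.le) hab hh'pos hh'le
    (fun s hs => (hleg1 s hs).1) (fun s hs => (hleg1 s hs).2) (fun s hs => (hleg1 s hs).2)
  -- leg 2: base `K₂ = dWaveSourceTorus (L+1) U μ h'`, direction `Y_L`, observable `O`, `t ∈ [h', s₀]`
  set K₂ := dWaveSourceTorus (L + 1) U μ h' with hK₂def
  have hK₂ : K₂.IsHermitian := dWaveSourceTorus_isHermitian (L + 1) hK h'
  have budget2 := cw_susceptibilityBudget K₂ O (Y L) hK₂ hO (hY L) c₁ (V₁ * n2) a₁ b₁ h' s₀ hc₁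
    (mul_nonneg hV₁ hn2pos.le) hab₁ hh'pos hh'le
    (fun t ht => (hleg2 t ht).1) (fun t ht => (hleg2 t ht).2.1) (fun t ht => (hleg2 t ht).2.2)
  -- the two legs meet: `K₂ - s₀ Y = K₁ - h' O`
  have hmeet : K₂ - (s₀ : ℂ) • Y L = K₁ - (h' : ℂ) • O := by
    rw [hK₂def, hK₁def, dWaveSourceTorus_eq, sub_right_comm]
  -- corner value: `2 A n2 ≤ Re ω_{K₁ - s₀ O}(O)`
  have hcornerO : 2 * (A * n2) ≤ ((K₁ - (s₀ : ℂ) • O).groundStateFunctional O).re := by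
    have h1 : A * n2 ≤ ((K₁ - (s₀ : ℂ) • O).groundStateFunctional P).re := by
      have := (le_div_iff₀ hn2pos).1 hAL
      simpa [hK₁def, hOdef, hPdef, hKdef] using this
    rw [hOdef, map_add, Complex.add_re, groundStateFunctional_conjTranspose_re]
    linarith
  -- budgets: drop the `h'`-terms
  have hb1 : 2 * (V * n2) / (c * (1 - (a + b))) * (s₀ ^ (1 - (a + b)) - h' ^ (1 - (a + b))) ≤
      2 * n2 * (V / (c * (1 - (a + b))) * s₀ ^ (1 - (a + b))) := by
    have hpos : 0 ≤ 2 * (V * n2) / (c * (1 - (a + b))) := by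
      apply div_nonneg (by positivity)
      exact (mul_pos hc he₁pos).le
    have hh'pow : 0 ≤ h' ^ (1 - (a + b)) := Real.rpow_nonneg hh'pos.le _
    have : 2 * (V * n2) / (c * (1 - (a + b))) * (s₀ ^ (1 - (a + b)) - h' ^ (1 - (a + b))) ≤
        2 * (V * n2) / (c * (1 - (a + b))) * s₀ ^ (1 - (a + b)) :=
      mul_le_mul_of_nonneg_left (by linarith) hpos
    refine this.trans (le_of_eq ?_)
    field_simp
  have hb2 : 2 * (V₁ * n2) / (c₁ * (1 - (a₁ + b₁))) * (s₀ ^ (1 - (a₁ + b₁)) - h' ^ (1 - (a₁ + b₁))) ≤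
      2 * n2 * (V₁ / (c₁ * (1 - (a₁ + b₁))) * s₀ ^ (1 - (a₁ + b₁))) := by
    have hpos : 0 ≤ 2 * (V₁ * n2) / (c₁ * (1 - (a₁ + b₁))) := by
      apply div_nonneg (by positivity)
      exact (mul_pos hc₁ he₂pos).le
    have hh'pow : 0 ≤ h' ^ (1 - (a₁ + b₁)) := Real.rpow_nonneg hh'pos.le _
    have : 2 * (V₁ * n2) / (c₁ * (1 - (a₁ + b₁))) * (s₀ ^ (1 - (a₁ + b₁)) - h' ^ (1 - (a₁ + b₁))) ≤
        2 * (V₁ * n2) / (c₁ * (1 - (a₁ + b₁))) * s₀ ^ (1 - (a₁ + b₁)) :=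
      mul_le_mul_of_nonneg_left (by linarith) hpos
    refine this.trans (le_of_eq ?_)
    field_simp
  -- chain the inequalities on `Re ω(O)` down to the diagonal point `K₂ - h' Y`
  have hchain : 2 * (A * n2) - 2 * n2 * (V / (c * (1 - (a + b))) * s₀ ^ (1 - (a + b)))
      - 2 * n2 * (V₁ / (c₁ * (1 - (a₁ + b₁))) * s₀ ^ (1 - (a₁ + b₁))) ≤
      ((K₂ - (h' : ℂ) • Y L).groundStateFunctional O).re := by
    have l1 := (abs_le.1 budget1)
    have l2 := (abs_le.1 budget2)
    rw [hmeet] at l2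
    linarith [l1.1, l1.2, l2.1, l2.2, hcornerO, hb1, hb2]
  -- back to `Δ_d`: `Re ω(P) = ½ Re ω(O)` and the core inequality
  have hOre : ((K₂ - (h' : ℂ) • Y L).groundStateFunctional O).re =
      2 * ((K₂ - (h' : ℂ) • Y L).groundStateFunctional P).re := by
    rw [hOdef, map_add, Complex.add_re, groundStateFunctional_conjTranspose_re]; ring
  rw [le_div_iff₀ hn2pos]
  have hfin : Real.exp (-C / U ^ 2) * n2 ≤
      (A - V / (c * (1 - (a + b))) * s₀ ^ (1 - (a + b)) - V₁ / (c₁ * (1 - (a₁ + b₁))) * s₀ ^ (1 - (a₁ + b₁))) * n2 :=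
    mul_le_mul_of_nonneg_right hineq hn2pos.le
  rw [hOre] at hchain
  have : (A - V / (c * (1 - (a + b))) * s₀ ^ (1 - (a + b)) - V₁ / (c₁ * (1 - (a₁ + b₁))) * s₀ ^ (1 - (a₁ + b₁))) * n2
      ≤ ((K₂ - (h' : ℂ) • Y L).groundStateFunctional P).re := by nlinarith [hchain]
  exact hfin.trans this

end Summit.HubbardSuperconductivity.HubbardSuperconductivity.Theorems
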